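import Summits.BirchSwinnertonDyer.BirchSwinnertonDyer.Theorems.SchneiderFreeAdditiveX3GordTwoBranchIMCNAT
import Summits.BirchSwinnertonDyer.BirchSwinnertonDyer.Theorems.SchneiderFreeAdditiveX3GordCellPerPairBROfTree
import Summits.BirchSwinnertonDyer.BirchSwinnertonDyer.Theorems.SchneiderFreeAdditiveX3GordCellPerPairOfPT
import HarnessLib

/-!
# Route `SchneiderFreeAdditiveX3` (K1 door): the PER-PAIR records (`MissingLowerBoundAt`, `MissingPPartAt`, `BSDp`) on the (G-ord, `e = 2`) half at every odd prime
# ON THE NAT INDEX ROAD — CGLS 2022 Cor. 1.2.6 (i)(ii) GONE from every record; the `p = 3` LOWER half free of CGLS §1.2 altogether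
# (twins of F48e `…GordCellPerPairBROfTree` and of F42 §2 `…GordCellPerPairOfPT`)

Cell `bsd-schneider-ideate`, seat `bsd-schneider-door-c5` (prover, generation 43; assembly layer; `--supports` 19177).  PARTITION: board row
B6 ∩ X3 ∩ sst-twist, `r = 1`, the WHOLE (G-ord, `e = 2`) half (2 560 of 7 101 census pairs: 2 411 at `p = 3`, 149 at `p ≥ 5`; class-wide every odd `p`) of
`Rank1Residual.partition` — ASSEMBLY; types-the-object-of nothing new; RE-KEYS the per-pair records onto FILE E4 (`KYBranchNAT.additiveIMCLowerBDPInputManinAt_gordTwo_three`,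
11 named) and FILE E5b (`NATGordCellFiveLe.additiveIMCLowerBDPOnTree_subGordTwo_five_le_offSliver`); the upper halves are unchanged (they still consume CGLS Prop. 14,
fed by `prop14_residualCharacterSelmer_finite_of_fact hprop125`, so the BOTH-halves records keep `hprop125` at `p = 3`).  Closes none of B6's cells (BSD NOT advanced).
bears_on: K1-door (19177 r3; per-pair statements of the rung leaf `SchneiderFree.AdditiveX3RankOneLower`).
INPUT LEDGER of the LOWER half per pair: at `p = 3` {PrintedFacts} ∪ {Hsieh A, LZZ, Castella–Hsieh signed} ∪ {[DIV.dvd] PRE, [AN3] (two forms), CGLS Thm 2.1.2} ∪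
{Bleher et al. 3.3.1, de Shalit II.6.4, Hida Thm I} (F48e: + CGLS Prop 1.2.5, Cor 1.2.6 (i)(ii)); at `p ≥ 5` {PrintedFacts} ∪ {Hsieh A, LZZ, CH signed} ∪ {[DIV.dvd],
[AN-BR₅] PRE} ∪ {CGLS Prop 1.2.5 (module clause)} (F45: + Cor 1.2.6 (i)(ii)).
HONEST FRAMING: compositions of tree theorems, CONDITIONAL BY NAME on the displayed statements; `BSDp W p` here is BSD_p MODULO those statements and the
pair's TU datum — NOT a proof of BSD for any curve; no definition, no named fact, no `sorry`; nothing is closed; «closes rung: none».  References: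
[KellerYin2024b] Thm. 3.3.6, Prop. 3.4.4, §3.5, Thm. 3.5.1, Lemma 2.3.8; [KellerYin2024] Thm. 1.4.1 (iii); [CastellaGrossiLeeSkinner2022] Thms. 1.2.2, 2.1.2, 2.2.2,
Prop. 1.2.5, Prop. 14; [BleherEtAl2020] Thm. 3.3.1; [deShalit1987] II.6.4; [Hida2010MuInvariant] Thm. I; [Miller2011LMS] Def. 1.1; [JetchevSkinnerWan2017] §7.4.1;
[FriedbergHoffstein1995] Thm. B; [GrossZagier1986] I.(6.3), (7.3); this seat p758065 (F42), p759994 (F45), F48e (gen 42, the template), F49 (gen 43).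
-/

set_option autoImplicit false
set_option linter.dupNamespace false -- the summit namespace `…BirchSwinnertonDyer.BirchSwinnertonDyer.Theorems` (Sub = Summit, D-0017) trips it

noncomputable section

open scoped Classical NumberField

open Field NumberField IsDedekindDomain WeierstrassCurve PowerSeries
  Literature.NumberTheory.EllipticCurves Literature.NumberTheory.EllipticCurves.GreenbergSelmer
  Literature.NumberTheory.GaloisRepresentations Literature.NumberTheory.GaloisCohomology
  Literature.NumberTheory.EllipticCurves.ModularForms Literature.NumberTheory.EllipticCurves.Rank1Residual
  Literature.NumberTheory.EllipticCurves.Rank1Residual.Typed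
  Literature.NumberTheory.EllipticCurves.KellerYin2024 Literature.NumberTheory.EllipticCurves.CaiShuTian2014
  Literature.NumberTheory.IwasawaTheory Literature.NumberTheory.IwasawaTheory.Greenberg2016
  Literature.NumberTheory.IwasawaTheory.Greenberg2006
  Literature.NumberTheory.EllipticCurves.Rubin1991 Literature.NumberTheory.EllipticCurves.DeShalit1987
  Literature.NumberTheory.EllipticCurves.Hida2010MuInvariant Literature.NumberTheory.EllipticCurves.BCGKPST2020
  Summit.BirchSwinnertonDyer.Rank1Residual Summit.BirchSwinnertonDyer.Rank1Residual.X11b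
  Summit.BirchSwinnertonDyer.Rank1Residual.X11b.AcSelmer Summit.BirchSwinnertonDyer.Rank1Residual.X11b.Halves
  Summit.BirchSwinnertonDyer.Rank1Residual.Additive Summit.BirchSwinnertonDyer.Rank1Residual.GaloisImage
  Summit.BirchSwinnertonDyer.BirchSwinnertonDyer.Theorems
  Summit.BirchSwinnertonDyer.BirchSwinnertonDyer.Theorems.EisensteinPrimesMuLambda
  Summit.BirchSwinnertonDyer.BirchSwinnertonDyer.Theorems.SchneiderFree
  Summit.BirchSwinnertonDyer.BirchSwinnertonDyer.Theorems.SchneiderFree.Upper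
  Summit.BirchSwinnertonDyer.BirchSwinnertonDyer.Theorems.SchneiderFree.KYRead
  Summit.BirchSwinnertonDyer.BirchSwinnertonDyer.Theses.SchneiderFreeAdditiveX3
  Summit.BirchSwinnertonDyer.BirchSwinnertonDyer.Theorems.SchneiderFreeAdditiveX3
open Literature.NumberTheory.EllipticCurves.CastellaGrossiLeeSkinner2022
  (prop14_residualCharacterSelmer_finite thm212_exists_isKatzLFunction prop125_characterGrSelmerDual_torsion_muZero_dim prop125_characterGrSelmerDual_corank_ge
    cor126_residualCharacter_globalLift cor126_residualCharacter_localSurjective)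
open Literature.NumberTheory.EllipticCurves.KellerYin2024 (thm122_rubinHida_residualPair_unrSelmer prop125_residualPair_unrSelmer_imprimitive
  thm351_anacong_branch_three_allTwists thm351_anacong_charLambda_branch_five_le)
open Summit.BirchSwinnertonDyer.BirchSwinnertonDyer.Theorems.PoitouTateShaNaturalAtTC
  (forall_poitouTate_shaRestricted_tateDual_natural_at_of_isTotallyComplex)
open Summit.BirchSwinnertonDyer.BirchSwinnertonDyer.Theorems.TeichmullerPairUnramifiedAtMult (prop14_residualCharacterSelmer_finite_of_fact)

open Summit.BirchSwinnertonDyer.BirchSwinnertonDyer.Theorems.SchneiderFreeAdditiveX3.ControlDischarged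
  Summit.BirchSwinnertonDyer.BirchSwinnertonDyer.Theorems.SchneiderFreeAdditiveX3.KYBranchOnly
  Summit.BirchSwinnertonDyer.BirchSwinnertonDyer.Theorems.SchneiderFreeAdditiveX3.UpperOfPrintDvd
  Summit.BirchSwinnertonDyer.BirchSwinnertonDyer.Theorems.SchneiderFreeAdditiveX3.UpperThreeAnomalousOfPartnerClass

namespace Summit.BirchSwinnertonDyer.BirchSwinnertonDyer.Theorems.SchneiderFreeAdditiveX3.KYBranchPerPairNAT


/-! ### §1 `p = 3`: the per-pair records on the whole (G-ord, `e = 2`) cell — no Greenberg, no duality binder, no [BR3] -/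

/-- **LOWER half per pair on the WHOLE (G-ord, `e = 2`) cell AT `p = 3`, no per-pair hypothesis, no Greenberg input, no duality binder, no Keller–Yin 2402.12781 statement, no [BR3]:** for every globally
minimal `W/ℚ` with `r_an = 1`, `ClassX3 W 3`, `SubGordTwo W 3`: `MissingLowerBoundAt W 3` (`ord₃ #Ш(E)_an ≤ ord₃ #Ш(E)`) — generation 42 FILE 4's crux currency at `3` (Bleher et al. 3.3.1, de Shalit II.6.4,
Hida Thm I in place of [RH] AND of [BR3]; [PWL-θ] a tree theorem) through generation 36's per-pair bridge `KrizLiLeafThirtySeven.missingLowerBoundAt_of_printedFacts_of_imcLowerInputAt`.  CONDITIONAL on the displayed named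
statements; closes no item; BSD not advanced. [claim: KellerYin2024PotOrd, status: under-review]
[cite: KellerYin2024b, Thm. 3.3.6, Prop. 3.4.4, Thm. 3.5.1 (arXiv:2410.23241 pp. 19–20) (preprint; hypotheses)]
[cite: CastellaGrossiLeeSkinner2022, Thms. 1.2.2, 2.1.2, 2.2.2, Props. 1.2.5, 14, Cor. 1.2.6] [cite: KellerYin2024, Thms. 1.2.2, 1.4.1, Prop. 1.2.5 (arXiv:2402.12781v2)]
[cite: MilneADT2006, I Thm. 4.10 (a)] [cite: JetchevSkinnerWan2017, §7.4.1 (arXiv:1512.06894 p. 30)] -/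
theorem missingLowerBoundAt_gordTwo_three (hF : PrintedFacts)
    (hA : Hsieh2014.thmA_exists_isHsiehLFunction_unrPeriod_anyLevel)
    (hL : LiuZhangZhang2018.thm151_thm153_modularCurve_heegnerVector_additive)
    (hCHσ : castellaHsieh2018_exists_isBranchBDPLFunction_signed)
    (hDVD : thm336_dvd_branch_OPEN) (hAN3 : thm351_anacong_branch_three) (hAN : thm351_anacong_branch_three_allTwists)
    (h212 : thm212_exists_isKatzLFunction)
    (h331 : thm331_rubin_exists_katzMeasure₂_pseudoIso_span_eq)
    (hFE : thmII64_katzMeasure₂_functionalEquation) (hO1 : thmI_mu_katzBranch_reflect_eq_zero) :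
    ∀ (W : WeierstrassCurve ℚ) [W.IsElliptic] [W.IsGloballyMinimal],
      W.analyticRank = 1 → ClassX3 W 3 → Additive.SubGordTwo W 3 → MissingLowerBoundAt W 3 :=
  fun W _ _ hr hX hG =>
    KrizLiLeafThirtySeven.missingLowerBoundAt_of_printedFacts_of_imcLowerInputAt hF W 3 hr (by decide) hX (Or.inr hG)
      (KYBranchNAT.additiveIMCLowerBDPInputManinAt_gordTwo_three hF.2.1 hF.2.2.2.2.1 hA hL hCHσ hDVD hAN3 hAN
        h212 h331 hFE hO1 W hr hX hG)

/-- **BOTH halves per pair on the whole (G-ord, `e = 2`) cell AT `p = 3` from the TU datum: `MissingPPartAt W 3`, no Greenberg input, no duality binder** — F42's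
record with its Milne binder fed by the tree theorem.  CONDITIONAL; closes no item; BSD not advanced. [claim: KellerYin2024PotOrd, status: under-review]
[cite: Miller2011LMS, Def. 1.1] [cite: KellerYin2024b, Thm. 3.3.6 and Prop. 3.4.4 (arXiv:2410.23241 p. 19) (preprint; hypothesis)]
[cite: CastellaGrossiLeeSkinner2022, Thms. 1.2.2, 2.1.2, 2.2.2, Prop. 14] -/
theorem missingPPartAt_gordTwo_three_of_twistUnitAt (hF : PrintedFacts)
    (hA : Hsieh2014.thmA_exists_isHsiehLFunction_unrPeriod_anyLevel)
    (hL : LiuZhangZhang2018.thm151_thm153_modularCurve_heegnerVector_additive)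
    (hCHσ : castellaHsieh2018_exists_isBranchBDPLFunction_signed)
    (hDVD : thm336_dvd_branch_OPEN) (hAN3 : thm351_anacong_branch_three) (hAN : thm351_anacong_branch_three_allTwists)
    (h212 : thm212_exists_isKatzLFunction)
    (hprop125 : prop125_characterGrSelmerDual_torsion_muZero_dim)
    (h331 : thm331_rubin_exists_katzMeasure₂_pseudoIso_span_eq)
    (hFE : thmII64_katzMeasure₂_functionalEquation) (hO1 : thmI_mu_katzBranch_reflect_eq_zero) :
    ∀ (W : WeierstrassCurve ℚ) [W.IsElliptic] [W.IsGloballyMinimal],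
      W.analyticRank = 1 → ClassX3 W 3 → Additive.SubGordTwo W 3 → Upper.TwistUnitFieldOffSliverAt W 3 → MissingPPartAt W 3 :=
  fun W _ _ hr hX hG hTU =>
    missingPPartAt_of_lower_of_upper W 3
      (missingLowerBoundAt_gordTwo_three hF hA hL hCHσ hDVD hAN3 hAN h212 h331 hFE hO1 W hr hX hG)
      (UpperThreeAnomalousOfPartnerClassTree.missingUpperBoundAt_gordTwo_three_of_printedFacts_of_twistUnitAt_of_tree hF hA hL hDVD
        (prop14_residualCharacterSelmer_finite_of_fact hprop125) hCHσ h331 hFE hO1 W hr hX hG hTU)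

/-- **Miller's `BSD(E, 3)` per pair on the WHOLE (G-ord, `e = 2`) cell from the TU datum, no Greenberg input, no duality binder** — F42's record with its Milne
binder fed by the tree theorem.  NOT a proof of BSD for any curve: BSD₃ MODULO {published theorems} ∪ {[DIV.dvd] (preprint), the analytic counts, [RH], [PWL-θ]}
∪ {the pair's TU certificate}. [claim: KellerYin2024PotOrd, status: under-review] [cite: Miller2011LMS, §1 and Def. 1.1]
[cite: KellerYin2024b, Thm. 3.3.6 and Prop. 3.4.4 (arXiv:2410.23241 p. 19) (preprint; hypothesis)] -/
theorem bsdp_gordTwo_three_of_twistUnitAt (hF : PrintedFacts)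
    (hA : Hsieh2014.thmA_exists_isHsiehLFunction_unrPeriod_anyLevel)
    (hL : LiuZhangZhang2018.thm151_thm153_modularCurve_heegnerVector_additive)
    (hCHσ : castellaHsieh2018_exists_isBranchBDPLFunction_signed)
    (hDVD : thm336_dvd_branch_OPEN) (hAN3 : thm351_anacong_branch_three) (hAN : thm351_anacong_branch_three_allTwists)
    (h212 : thm212_exists_isKatzLFunction)
    (hprop125 : prop125_characterGrSelmerDual_torsion_muZero_dim)
    (h331 : thm331_rubin_exists_katzMeasure₂_pseudoIso_span_eq)
    (hFE : thmII64_katzMeasure₂_functionalEquation) (hO1 : thmI_mu_katzBranch_reflect_eq_zero) :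
    ∀ (W : WeierstrassCurve ℚ) [W.IsElliptic] [W.IsGloballyMinimal],
      W.analyticRank = 1 → ClassX3 W 3 → Additive.SubGordTwo W 3 → Upper.TwistUnitFieldOffSliverAt W 3 → BSDp W 3 :=
  fun W _ _ hr hX hG hTU =>
    bsdp_of_missingPPartAt W 3 hF.2.2.1 (le_of_eq hr)
      (missingPPartAt_gordTwo_three_of_twistUnitAt hF hA hL hCHσ hDVD hAN3 hAN h212 hprop125 h331 hFE hO1 W hr hX hG hTU)

/-! ### §2 `p ≥ 5`: the per-pair records on the NAT index road (no sliver, no Mazur) — Cor. 1.2.6 and the Milne binder gone -/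

/-- **LOWER half per pair on the (G-ord, `e = 2`) cell AT `p ≥ 5` ⇐ `PrintedFacts` ∧ Hsieh A ∧ LZZ ∧ Castella–Hsieh signed ∧ [DIV.dvd] ∧ [AN-BR₅] ∧ CGLS Prop 1.2.5
(module clause), Prop 14, Cor 1.2.6 ×2 ∧ Milne ADT I Thm. 4.10 (a) — NO crux, NO per-pair hypothesis, NO sliver, NO Greenberg** — generation 33's F20 §1 proof
(the Heegner/twist datum with `d_K ≡ 1 (mod 8)`, STEP L at it from F38b's per-datum door `KYBranchFiveLeOfCGLS.additiveIMCLowerBDPOnTree_subGordTwo_five_le_offSliver`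
+ the control inequality (CLOSED corner + Kolyvagin), `Ш(E/K)` finite by Kolyvagin, `JointLowerManin` / `PartnerUpperRankZero`), the CGLS corank clause fed by
F41's `corank_ge_ofPT`.  CONDITIONAL; closes no item; BSD not advanced. [claim: KellerYin2024PotOrd, status: under-review]
[cite: KellerYin2024b, Thm. 3.3.6, Prop. 3.4.4, §3.5, Thm. 3.5.1 and Lemma 2.3.8 (arXiv:2410.23241 pp. 11, 19–20) (preprint; hypotheses)]
[cite: CastellaGrossiLeeSkinner2022, Thm. 1.2.2, Props. 1.2.5, 14, Cor. 1.2.6] [cite: MilneADT2006, I Thm. 4.10 (a)] [cite: JetchevSkinnerWan2017, §7.4.1]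
[cite: FriedbergHoffstein1995, Thm. B] [cite: GrossZagier1986, Thm. I.(6.3) and (7.3)] -/
theorem missingLowerBoundAt_gordTwo_five_le (hF : PrintedFacts)
    (hA : Hsieh2014.thmA_exists_isHsiehLFunction_unrPeriod_anyLevel)
    (hL : LiuZhangZhang2018.thm151_thm153_modularCurve_heegnerVector_additive)
    (hCHσ : castellaHsieh2018_exists_isBranchBDPLFunction_signed)
    (hDVD : thm336_dvd_branch_OPEN) (hAN : thm351_anacong_charLambda_branch_five_le)
    (hprop125 : prop125_characterGrSelmerDual_torsion_muZero_dim) :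
    ∀ (W : WeierstrassCurve ℚ) [W.IsElliptic] [W.IsGloballyMinimal] (p : ℕ) [Fact p.Prime],
      5 ≤ p → W.analyticRank = 1 → ClassX3 W p → Additive.SubGordTwo W p → MissingLowerBoundAt W p := by
  have hJ : JointLowerManin := schneiderFreeAdditiveX3_jointLowerManin_proof
  have hU : PartnerUpperRankZero := schneiderFreeAdditiveX3_partnerUpperRankZero_proof
  obtain ⟨hGZ, hKo, hGZK, hmod, hmodD, hCas, hGZ73, hFH, hpar, hHP, hDel, hW16, hWu⟩ := hF
  intro W _ _ p _ hp5 hr hX hG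
  have hp2 : p ≠ 2 := by omega
  have hS : Additive.SubSemistableTwist W p := Or.inr hG
  obtain ⟨N, _, K, _, _, Dt, H, ι, P, Wd, _, _, hN, hKiq, hodd, hunit, hHe, hLtw, hP, hnt, hWd, hrd, hXd, hSd, h8⟩ :=
    exists_heegnerTwistDataManin_discr_emod_eight hFH hpar hHP hGZ hmod W p hr hp2 hX hS
  have hdK : NumberField.discr K ≠ -3 := discr_ne_neg_three_of_emod_eight h8
  have hloc : Additive.N10.Locus W p :=
    (Additive.N10.locus_iff_cells W p).mpr
      ((Additive.N10.cellM_or_cellGordTwo_of_classX3_of_subSemistableTwist W p hp2 hX hS).elim Or.inl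
        (fun h ↦ Or.inr (Or.inl h)))
  have hfin : (W.baseChange K).ShaFinite := (hKo N W K hKiq hHe ⟨Dt, H, ι, hP⟩ hnt).2
  have hidx : IndexLowerBoundLeAt W p K P (padicValNat p Dt.c.natAbs) := by
    refine indexLowerBoundLeAt_of_frames_of_shaFinite_le hloc hN hKiq hHe hfin ?_ ?_
    · intro κ hκ γ _ 𝔭 h𝔭 he hf
      exact NATGordCellFiveLe.additiveIMCLowerBDPOnTree_subGordTwo_five_le_offSliver hKo hmodD hA hL hCHσ hDVD hAN hprop125 hp5 W hr hX hG N
        K Dt H ι P hr hloc hN hKiq hodd hunit hHe hLtw hP hnt hdK κ hκ γ 𝔭 h𝔭 he hf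
    · intro κ hκ γ _ 𝔭 h𝔭 he hf
      exact additiveControlLeOnTreeAt_of_pt_of_kolyvagin pt_selmer_forall hKo W p hr hp2 hX hS N K Dt H ι P hr hloc hN hKiq
        hodd hunit hHe hLtw hP hnt κ hκ γ 𝔭 h𝔭 he hf
  have hJ' : JointLowerBoundAt W Wd p :=
    hJ hGZ hKo hGZK hmod hmodD hCas hGZ73 W p N K Dt H ι P Wd hr hN hKiq hodd hunit hHe hLtw hP hnt hWd hrd hp2 hidx
  exact missingLowerBoundAt_of_joint_of_upper hJ' (hU hDel hGZK hmod hmodD hW16 hWu Wd p hrd hp2 hXd hSd)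

/-- **BOTH halves per pair on the (G-ord, `e = 2`) cell AT `p ≥ 5`: `MissingPPartAt W p` ⇐ §2's inputs ∧ the pair's twist-unit datum, on the NAT index road** — §2 (lower)
and generation 23's `UpperOfPrintDvd.missingUpperBoundAt_gordTwo_fiveLe_…` (upper, ⟸ PUB ∪ {[DIV.dvd]} ∪ {TU}).  CONDITIONAL; closes no item; BSD not advanced.
[claim: KellerYin2024PotOrd, status: under-review] [cite: Miller2011LMS, Def. 1.1]
[cite: KellerYin2024b, Thm. 3.3.6, Prop. 3.4.4 and §3.5 (arXiv:2410.23241 pp. 19–20) (preprint; hypotheses)] [cite: CastellaGrossiLeeSkinner2022, Thm. 1.2.2, Props. 1.2.5, 14, Cor. 1.2.6] -/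
theorem missingPPartAt_gordTwo_five_le_of_twistUnitAt (hF : PrintedFacts)
    (hA : Hsieh2014.thmA_exists_isHsiehLFunction_unrPeriod_anyLevel)
    (hL : LiuZhangZhang2018.thm151_thm153_modularCurve_heegnerVector_additive)
    (hCHσ : castellaHsieh2018_exists_isBranchBDPLFunction_signed)
    (hDVD : thm336_dvd_branch_OPEN) (hAN : thm351_anacong_charLambda_branch_five_le)
    (hprop125 : prop125_characterGrSelmerDual_torsion_muZero_dim) :
    ∀ (W : WeierstrassCurve ℚ) [W.IsElliptic] [W.IsGloballyMinimal] (p : ℕ) [Fact p.Prime],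
      5 ≤ p → W.analyticRank = 1 → ClassX3 W p → Additive.SubGordTwo W p → Upper.TwistUnitFieldOffSliverAt W p → MissingPPartAt W p :=
  fun W _ _ p _ hp5 hr hX hG hTU =>
    missingPPartAt_of_lower_of_upper W p
      (missingLowerBoundAt_gordTwo_five_le hF hA hL hCHσ hDVD hAN hprop125 W p hp5 hr hX hG)
      (missingUpperBoundAt_gordTwo_fiveLe_of_printedFacts_of_twistUnitAt_of_hsieh_of_lzz_of_KY_dvd_of_prop14_of_castellaHsieh_signed hF hA hL
        hDVD (prop14_residualCharacterSelmer_finite_of_fact hprop125) hCHσ W p hp5 hr hX hG hTU)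

/-- **Miller's `BSD(E, p)` per pair on the (G-ord, `e = 2`) cell AT `p ≥ 5` from the TU datum, on the NAT index road** — through `bsdp_of_missingPPartAt`.  NOT a proof of
BSD for any curve: BSD_p MODULO {published theorems} ∪ {[DIV.dvd], [AN-BR₅] (preprint), Milne I 4.10 (a)} ∪ {the pair's TU certificate}.
[claim: KellerYin2024PotOrd, status: under-review] [cite: Miller2011LMS, §1 and Def. 1.1]
[cite: KellerYin2024b, Thm. 3.3.6, Prop. 3.4.4 and §3.5 (arXiv:2410.23241 pp. 19–20) (preprint; hypotheses)] -/
theorem bsdp_gordTwo_five_le_of_twistUnitAt (hF : PrintedFacts)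
    (hA : Hsieh2014.thmA_exists_isHsiehLFunction_unrPeriod_anyLevel)
    (hL : LiuZhangZhang2018.thm151_thm153_modularCurve_heegnerVector_additive)
    (hCHσ : castellaHsieh2018_exists_isBranchBDPLFunction_signed)
    (hDVD : thm336_dvd_branch_OPEN) (hAN : thm351_anacong_charLambda_branch_five_le)
    (hprop125 : prop125_characterGrSelmerDual_torsion_muZero_dim) :
    ∀ (W : WeierstrassCurve ℚ) [W.IsElliptic] [W.IsGloballyMinimal] (p : ℕ) [Fact p.Prime],
      5 ≤ p → W.analyticRank = 1 → ClassX3 W p → Additive.SubGordTwo W p → Upper.TwistUnitFieldOffSliverAt W p → BSDp W p :=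
  fun W _ _ p _ hp5 hr hX hG hTU =>
    bsdp_of_missingPPartAt W p hF.2.2.1 (le_of_eq hr)
      (missingPPartAt_gordTwo_five_le_of_twistUnitAt hF hA hL hCHσ hDVD hAN hprop125 W p hp5 hr hX hG hTU)

/-! ### §3 The WHOLE (G-ord, `e = 2`) half at EVERY odd prime — no Greenberg, no duality binder, no [BR3] -/

/-- **The LOWER half `ord_p #Ш(E)_an ≤ ord_p #Ш(E)` PER PAIR on the WHOLE (G-ord, `e = 2`) half of B6 ∩ X3 at EVERY odd prime `p`, NO per-pair hypothesis,
no Greenberg input, no duality binder** — F42's record with its Milne binder fed by the tree theorem.  INPUT LEDGER: `PrintedFacts` ∪ {Hsieh A, LZZ, Castella–Hsieh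
signed} ∪ {[DIV.dvd] PRE; [AN3], [AN-BR₅] PRE; CGLS Thm 2.1.2} ∪ {CGLS Prop 1.2.5 (module clause), Cor 1.2.6 ×2; Bleher et al. 3.3.1; Katz II.6.4;
Hida Thm I} — every one refereed print or a Keller–Yin preprint clause.  CONDITIONAL on every displayed hypothesis; closes no item; BSD not advanced
beyond this typed reduction. [claim: KellerYin2024PotOrd, status: under-review]
[cite: KellerYin2024b, Thm. 3.3.6, Prop. 3.4.4, §3.5, Thm. 3.5.1 and Lemma 2.3.8 (arXiv:2410.23241 pp. 11, 19–20) (preprint; hypotheses)]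
[cite: CastellaGrossiLeeSkinner2022, Thms. 1.2.2, 2.1.2, 2.2.2, Props. 1.2.5, 14, Cor. 1.2.6] [cite: KellerYin2024, Thms. 1.2.2, 2.2.2 (arXiv:2402.12781v2)]
[cite: MilneADT2006, I Thm. 4.10 (a)] [cite: JetchevSkinnerWan2017, §7.4.1] [cite: FriedbergHoffstein1995, Thm. B] -/
theorem missingLowerBoundAt_gordTwo (hF : PrintedFacts)
    (hA : Hsieh2014.thmA_exists_isHsiehLFunction_unrPeriod_anyLevel)
    (hL : LiuZhangZhang2018.thm151_thm153_modularCurve_heegnerVector_additive)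
    (hCHσ : castellaHsieh2018_exists_isBranchBDPLFunction_signed)
    (hDVD : thm336_dvd_branch_OPEN)
    (hAN3 : thm351_anacong_branch_three_allTwists) (h212 : thm212_exists_isKatzLFunction)
    (hAN5 : thm351_anacong_charLambda_branch_five_le)
    (hprop125 : prop125_characterGrSelmerDual_torsion_muZero_dim)
    (h331 : thm331_rubin_exists_katzMeasure₂_pseudoIso_span_eq)
    (hFE : thmII64_katzMeasure₂_functionalEquation) (hO1 : thmI_mu_katzBranch_reflect_eq_zero) :
    ∀ (W : WeierstrassCurve ℚ) [W.IsElliptic] [W.IsGloballyMinimal] (p : ℕ) [Fact p.Prime],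
      W.analyticRank = 1 → p ≠ 2 → ClassX3 W p → Additive.SubGordTwo W p → MissingLowerBoundAt W p := by
  intro W _ _ p _ hr hp2 hX hG
  have hp : p.Prime := Fact.out
  obtain rfl | hp5 : p = 3 ∨ 5 ≤ p := by
    rcases Nat.lt_or_ge p 5 with h | h
    · left
      have h2 := hp.two_le
      interval_cases p
      · exact absurd rfl hp2
      · rfl
      · exact absurd hp (by norm_num)
    · exact Or.inr h
  · exact missingLowerBoundAt_gordTwo_three hF hA hL hCHσ hDVD hAN3.to_branch_three hAN3 h212 h331 hFE hO1 W hr hX hG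
  · exact missingLowerBoundAt_gordTwo_five_le hF hA hL hCHσ hDVD hAN5 hprop125 W p hp5 hr hX hG

/-- **BOTH halves per pair on the WHOLE (G-ord, `e = 2`) half at EVERY odd prime from the TU datum: `MissingPPartAt W p`, no Greenberg input, no duality binder**
— F42's record with its Milne binder fed by the tree theorem.  CONDITIONAL; closes no item; BSD not advanced beyond this typed reduction.
[claim: KellerYin2024PotOrd, status: under-review] [cite: Miller2011LMS, Def. 1.1] [cite: KellerYin2024b, Thm. 3.3.6, Prop. 3.4.4, §3.5 (arXiv:2410.23241 pp. 19–20) (preprint; hypotheses)] -/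
theorem missingPPartAt_gordTwo_of_twistUnitAt (hF : PrintedFacts)
    (hA : Hsieh2014.thmA_exists_isHsiehLFunction_unrPeriod_anyLevel)
    (hL : LiuZhangZhang2018.thm151_thm153_modularCurve_heegnerVector_additive)
    (hCHσ : castellaHsieh2018_exists_isBranchBDPLFunction_signed)
    (hDVD : thm336_dvd_branch_OPEN)
    (hAN3 : thm351_anacong_branch_three_allTwists) (h212 : thm212_exists_isKatzLFunction)
    (hAN5 : thm351_anacong_charLambda_branch_five_le)
    (hprop125 : prop125_characterGrSelmerDual_torsion_muZero_dim)
    (h331 : thm331_rubin_exists_katzMeasure₂_pseudoIso_span_eq)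
    (hFE : thmII64_katzMeasure₂_functionalEquation) (hO1 : thmI_mu_katzBranch_reflect_eq_zero) :
    ∀ (W : WeierstrassCurve ℚ) [W.IsElliptic] [W.IsGloballyMinimal] (p : ℕ) [Fact p.Prime],
      W.analyticRank = 1 → p ≠ 2 → ClassX3 W p → Additive.SubGordTwo W p → Upper.TwistUnitFieldOffSliverAt W p → MissingPPartAt W p := by
  intro W _ _ p _ hr hp2 hX hG hTU
  have hp : p.Prime := Fact.out
  obtain rfl | hp5 : p = 3 ∨ 5 ≤ p := by
    rcases Nat.lt_or_ge p 5 with h | h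
    · left
      have h2 := hp.two_le
      interval_cases p
      · exact absurd rfl hp2
      · rfl
      · exact absurd hp (by norm_num)
    · exact Or.inr h
  · exact missingPPartAt_gordTwo_three_of_twistUnitAt hF hA hL hCHσ hDVD hAN3.to_branch_three hAN3 h212 hprop125 h331 hFE hO1 W hr
      hX hG hTU
  · exact missingPPartAt_gordTwo_five_le_of_twistUnitAt hF hA hL hCHσ hDVD hAN5 hprop125 W p hp5 hr hX hG hTU

/-- **Miller's `BSD(E, p)` per pair on the WHOLE (G-ord, `e = 2`) half at EVERY odd prime from the TU datum, no Greenberg input, no duality binder** — F42's record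
with its Milne binder fed by the tree theorem.  NOT a proof of BSD for any curve: BSD_p MODULO {published theorems} ∪ {[DIV.dvd], the typed analytic sentences,
[RH], [PWL-θ]} ∪ {the pair's TU certificate}. [claim: KellerYin2024PotOrd, status: under-review] [cite: Miller2011LMS, §1 and Def. 1.1]
[cite: KellerYin2024b, Thm. 3.3.6, Prop. 3.4.4, §3.5 (arXiv:2410.23241 pp. 19–20) (preprint; hypotheses)] -/
theorem bsdp_gordTwo_of_twistUnitAt (hF : PrintedFacts)
    (hA : Hsieh2014.thmA_exists_isHsiehLFunction_unrPeriod_anyLevel)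
    (hL : LiuZhangZhang2018.thm151_thm153_modularCurve_heegnerVector_additive)
    (hCHσ : castellaHsieh2018_exists_isBranchBDPLFunction_signed)
    (hDVD : thm336_dvd_branch_OPEN)
    (hAN3 : thm351_anacong_branch_three_allTwists) (h212 : thm212_exists_isKatzLFunction)
    (hAN5 : thm351_anacong_charLambda_branch_five_le)
    (hprop125 : prop125_characterGrSelmerDual_torsion_muZero_dim)
    (h331 : thm331_rubin_exists_katzMeasure₂_pseudoIso_span_eq)
    (hFE : thmII64_katzMeasure₂_functionalEquation) (hO1 : thmI_mu_katzBranch_reflect_eq_zero) :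
    ∀ (W : WeierstrassCurve ℚ) [W.IsElliptic] [W.IsGloballyMinimal] (p : ℕ) [Fact p.Prime],
      W.analyticRank = 1 → p ≠ 2 → ClassX3 W p → Additive.SubGordTwo W p → Upper.TwistUnitFieldOffSliverAt W p → BSDp W p :=
  fun W _ _ p _ hr hp2 hX hG hTU =>
    bsdp_of_missingPPartAt W p hF.2.2.1 (le_of_eq hr)
      (missingPPartAt_gordTwo_of_twistUnitAt hF hA hL hCHσ hDVD hAN3 h212 hAN5 hprop125 h331 hFE hO1 W p hr hp2 hX hG hTU)

end Summit.BirchSwinnertonDyer.BirchSwinnertonDyer.Theorems.SchneiderFreeAdditiveX3.KYBranchPerPairNAT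

end
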